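import Mathlib
import Literature.MathematicalPhysics.StatisticalMechanics.PeriodicConfigurationSums
import HarnessLib

/-!
# Crux `PatternPricedCertificates` (stmt-AtomisticToContinuum-12974), line `registered` — stub `stub_periodicTruncatedEnergy`

This file discharges the registered tool stub `stub_periodicTruncatedEnergy` (T3) of line
`registered` for crux stmt-AtomisticToContinuum-12974
(`Summit.AtomisticToContinuum.Crystallization.Theses.FrustrationRangeCertificates.PatternPricedCertificates`).

**Statement.** For a periodic configuration `Q` of `ℝ³` and a point `x`, the rooted `ρ`-pattern of
`Q` at `x` is the finite set `{y − x | y ∈ Q.points, y ≠ x, dist y x ≤ ρ}`, written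
`((Q.finite_inter_points isBounded_closedBall).toFinset.erase x).image (· − x)`. The truncated
Lennard-Jones energy per particle `(#motif)⁻¹ Σ_{x ∈ motif} ½ Σ_{v ∈ pattern at x within ρ} V_LJ ‖v‖`
converges, as `ρ → ∞`, to the energy per particle
`e(Q) = (2 #motif)⁻¹ Σ_{x ∈ motif} Σ'_{y ∈ Q.points, y ≠ x} V_LJ (dist x y)`
(`PeriodicConfiguration.energyPerParticle`).

**Proof.** One centre at a time (`periodicTruncatedEnergy_tendsto_sum_pattern`): the one-centre sum
`y ↦ V_LJ (dist x y)` over `{y // y ∈ Q.points ∧ y ≠ x}` has a genuine sum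
(`PeriodicConfiguration.hasSum_lennardJones_dist_three`), i.e. its finite partial sums converge along
`atTop (Finset _)`; the ball finsets `{y | dist y x ≤ ρ}` are monotone in `ρ` and absorb every finite
set, so they tend to `atTop`, and composing gives convergence of the ball sums; finally the ball sum
is the pattern sum (`y ↦ y − x` is injective and `‖y − x‖ = dist x y`). Averaging over the motif
(`tendsto_finsetSum`, `Tendsto.const_mul`, `Tendsto.div_const`) and the algebra
`(#F)⁻¹ Σ (s / 2) = (2 #F)⁻¹ Σ s` finish the proof.

No new definitions; nothing is assumed. [folklore]
-/

noncomputable section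

open scoped BigOperators Classical

namespace Summit.AtomisticToContinuum.Crystallization.Theorems.PatternPricedCertificates

open Filter Topology
open Literature.MathematicalPhysics.StatisticalMechanics (PeriodicConfiguration lennardJones)

/-- **One-centre truncated sums converge.** If the one-centre sum `y ↦ V (dist x y)` over the points
`y ≠ x` of a periodic configuration `Q` of `ℝ³` has sum `a`, then the sums of `V ‖v‖` over the rooted
`ρ`-patterns `{y − x | y ∈ Q.points, y ≠ x, dist y x ≤ ρ}` tend to `a` as `ρ → ∞` (closed balls are
monotone and exhaust every finite set of points). [folklore] -/
theorem periodicTruncatedEnergy_tendsto_sum_pattern (Q : PeriodicConfiguration 3) (V : ℝ → ℝ)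
    (x : EuclideanSpace ℝ (Fin 3)) {a : ℝ}
    (hV : HasSum (fun y : {y // y ∈ Q.points ∧ y ≠ x} => V (dist x y.1)) a) :
    Tendsto (fun ρ : ℝ => ∑ v ∈ ((Q.finite_inter_points
        (Metric.isBounded_closedBall (x := x) (r := ρ))).toFinset.erase x).image (fun y => y - x),
        V ‖v‖) atTop (𝓝 a) := by
  -- the punctured closed balls of `Q.points` around `x`, as finsets of the ambient space
  set B : ℝ → Finset (EuclideanSpace ℝ (Fin 3)) := fun ρ =>
    (Q.finite_inter_points (Metric.isBounded_closedBall (x := x) (r := ρ))).toFinset.erase x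
    with hB
  have hmem : ∀ ρ y, y ∈ B ρ ↔ y ∈ Q.points ∧ y ≠ x ∧ dist y x ≤ ρ := fun ρ y => by
    simp only [hB, Finset.mem_erase, Set.Finite.mem_toFinset, Set.mem_inter_iff,
      Metric.mem_closedBall]
    tauto
  -- the same balls, lifted to the index type of the one-centre sum
  let s : ℝ → Finset {y // y ∈ Q.points ∧ y ≠ x} := fun ρ =>
    (B ρ).subtype fun y => y ∈ Q.points ∧ y ≠ x
  have hs : Tendsto s atTop atTop := by
    refine Monotone.tendsto_atTop_atTop (fun ρ ρ' hρ y hy => ?_) fun t => ?_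
    · rw [Finset.mem_subtype, hmem] at hy ⊢
      exact ⟨hy.1, hy.2.1, hy.2.2.trans hρ⟩
    · obtain ⟨ρ, hρ⟩ :=
        (t.image fun y : {y // y ∈ Q.points ∧ y ≠ x} => dist y.1 x).exists_le
      refine ⟨ρ, fun y hy => ?_⟩
      rw [Finset.mem_subtype, hmem]
      exact ⟨y.2.1, y.2.2, hρ _ (Finset.mem_image_of_mem _ hy)⟩
  refine (hV.comp hs).congr fun ρ => ?_
  -- identify the partial sum over `s ρ` with the pattern sum
  rw [Function.comp_apply, Finset.sum_image sub_left_injective.injOn,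
    Finset.sum_subtype_of_mem (fun y => V (dist x y)) fun y hy => ((hmem ρ y).1 hy).imp_right
      And.left]
  exact Finset.sum_congr rfl fun y _ => by rw [dist_comm, dist_eq_norm]

/-- **Tool stub T3 (truncated energies converge to the energy per particle).** For every periodic
`Q` of `ℝ³`, `(#motif)⁻¹ Σ_{x ∈ motif} ½ Σ_{v ∈ pattern at x within ρ} V_LJ ‖v‖ → e(Q)` as `ρ → ∞`
(`hasSum_lennardJones_dist_three`: the one-centre sums are absolutely summable; balls exhaust the
point set). [folklore] -/
theorem stub_periodicTruncatedEnergy :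
    ∀ Q : Literature.MathematicalPhysics.StatisticalMechanics.PeriodicConfiguration 3,
      Filter.Tendsto (fun ρ : ℝ => (Q.motif.card : ℝ)⁻¹ * ∑ x ∈ Q.motif, (∑ v ∈ (((Literature.MathematicalPhysics.StatisticalMechanics.PeriodicConfiguration.finite_inter_points Q (Metric.isBounded_closedBall (x := x) (r := ρ))).toFinset.erase x).image (fun y => y - x)), Literature.MathematicalPhysics.StatisticalMechanics.lennardJones ‖v‖) / 2)
        Filter.atTop (nhds (Q.energyPerParticle Literature.MathematicalPhysics.StatisticalMechanics.lennardJones)) := by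
  intro Q
  have hlim : Q.energyPerParticle lennardJones = (Q.motif.card : ℝ)⁻¹ * ∑ x ∈ Q.motif,
      (∑' y : {y // y ∈ Q.points ∧ y ≠ x}, lennardJones (dist x y.1)) / 2 := by
    rw [PeriodicConfiguration.energyPerParticle, ← Finset.sum_div]
    ring
  rw [hlim]
  refine Tendsto.const_mul _ (tendsto_finsetSum _ fun x _ => ?_)
  exact (periodicTruncatedEnergy_tendsto_sum_pattern Q lennardJones x
    (Q.hasSum_lennardJones_dist_three x)).div_const 2

end Summit.AtomisticToContinuum.Crystallization.Theorems.PatternPricedCertificates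

end
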